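import Summits.QuantumFields.YangMills.Theorems.UnitScaleTiltProp7LandauTransversalityReduction
import Summits.QuantumFields.YangMills.Theorems.UnitScaleTiltProp7LandauDictT3
import Summits.QuantumFields.YangMills.Theorems.UnitScaleTiltProp7TwistedSliceGaugeOntoSU2
import Literature.Analysis.Complex.RungeUnits
import HarnessLib

/-!
# Route `UnitScaleTilt`, crux K1 child «MinimiserStabilityRegPr» (stmt-QuantumFields-19200), skeleton v10, stub `stub_existenceMinimalOrbit` (EX), route (α) —
# **(E1) THE DIVERGENCE OF THE ROTATED GAUGE DIRECTION IS `η`-FREE UNDER THE (19)-REGULARITY OF THE CHART POINT**: for `U′ = e^{A}U₀` with `‖A(b)‖ ≤ ε·η` and the DIAGONAL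
# covariant gradients `‖(∇_{U₀}A)_{μμ}‖ ≤ ε·η²` (clauses 1–2 of [Balaban1985Variational] (19), the knit's `hSize19` letter, supplied by ✓`Prop7Size19Orders01.orders01_of_eq111_T3`), the
# `U₀`-divergence of the ROTATION `b ↦ U′(b)N(b₊)U′(b)⁻¹ − U₀(b)N(b₊)U₀(b)⁻¹` of a gauge parameter `N` is bounded POINTWISE by `2e^{2εη}·ε·η·(3‖N(x)‖ + Σ_μ ‖(D_{U₀}N)(x, x+e_μ)‖)`
# — one `η` BETTER than the crude `‖D*‖·‖rotation‖ ~ ε` (LOCATE memo `pub/ym3-torus/ym-ust-20520-w5/g7/LOCATE-P2-MARGIN-w5g7.md` §3: the input (E1) of the pairing margin of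
# ✓`Prop7LandauTransversalityMargin.hcore_of_pairing`; WITHOUT clause 2 the first term is `2dε·‖N(x)‖` with NO `η`, and no L-only window closes).

Cell `ym3-torus`, width seat `ym-ust-20520-w5` (gen 7).  THEOREMS ONLY (0 `def`, 0 `sorry`).  `--supports stmt-QuantumFields-19200 --as helper`, count-neutral.  YM₃ on T³ is a
ladder rung (R3), not the Clay problem; nothing here claims the stub, the crux, d = 4 or the mass gap.

THE COMPUTATION (stencils ✓`Prop7SectET3HilbertLetters.DstarL2_apply` (3.8) and ✓`DL2_apply` (3.3)).  With `Y(b) := e^{A(b)}(U₀(b)N(b₊)U₀(b)⋆)e^{−A(b)} − U₀(b)N(b₊)U₀(b)⋆`: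
`(D*_{U₀}Y)(x) = η⁻¹Σ_μ [U₀(b⁻)⋆Y(b⁻)U₀(b⁻) − Y(b⁺)]`, `b⁺ = (x, x+e_μ)`, `b⁻ = (x−e_μ, x)`.  The `b⁻` term is `e^{Ã}N(x)e^{−Ã} − N(x)`, `Ã := U₀(b⁻)⋆A(b⁻)U₀(b⁻)`
(`e^{U⋆AU} = U⋆e^{A}U`); the `b⁺` term is `e^{A(b⁺)}(N(x) + η(D_{U₀}N)(b⁺))e^{−A(b⁺)} − (N(x) + η(D_{U₀}N)(b⁺))`.  Hence the summand is
`[e^{Ã}N(x)e^{−Ã} − e^{A(b⁺)}N(x)e^{−A(b⁺)}] − η[e^{A(b⁺)}(D_{U₀}N)(b⁺)e^{−A(b⁺)} − (D_{U₀}N)(b⁺)]`, and `Ã − A(b⁺) = −U₀(b⁻)⋆(∇_{U₀}A)_{μμ}(x−e_μ)U₀(b⁻)` is a DIAGONAL covariant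
gradient: `‖e^{P}Ze^{−P} − e^{Q}Ze^{−Q}‖ ≤ 2e^{2r}‖P − Q‖‖Z‖` (`‖P‖, ‖Q‖ ≤ r`) gives `‖summand‖ ≤ 2e^{2εη}(εη²‖N(x)‖ + εη·η‖(D_{U₀}N)(b⁺)‖)` and the `η⁻¹Σ_μ` in front leaves ONE `η`.

WHAT IS PROVED (sorry-free, no definition; ns `…Theorems.Prop7GaugeDirRotationDivergence`):
* §1 `norm_exp_conj_sub_exp_conj_le` — `‖e^{P}Ze^{−P} − e^{Q}Ze^{−Q}‖ ≤ 2e^{r}e^{r}‖P − Q‖‖Z‖` for `‖P‖, ‖Q‖ ≤ r` (any complete normed `ℂ`-algebra with `‖1‖ = 1`; lit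
  ✓`Literature.Analysis.Complex.norm_exp_sub_exp_le`); `norm_exp_conj_sub_self_le` (the case `Q = 0`).
* §2 `bneg_eq`, `shift_bneg`, `tgt_bneg` — the backward bond `b⁻ = (bondEquiv)⁻¹(x − e_μ, μ)` of the (3.8) stencil ends at `x` (forward bond: ✓`Prop7LandauDict.bondEquiv_symm_siteEquiv`);
  `coe_bgOfCfg_inv`, `star_mul_self_bg`, `norm_coe_bg` (unitarity letters); `norm_conjA_sub_le` (`‖Ã − A(b⁺)‖ ≤ ‖(∇_{U₀}A)_{μμ}(x − e_μ)‖`).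
* §3 `norm_stencil_summand_le` — one summand of the stencil (pure `M₂(ℂ)` algebra).
* §3 ★★★`norm_DstarPi_rot_le` — the displayed pointwise bound, for every `N` and every site `x`, under `‖A(b)‖ ≤ ε·η` (all `b`) and
  `‖covGradT 1 (bgUnits F K U₀) A μ μ x‖ ≤ ε·η²` (all `μ`, `x`).
HONEST SCOPE.  A pointwise stencil estimate; the `L²` summation (weights `c₀`, Frobenius vs operator norm on `M₂(ℂ)`), the bondwise `M⁻¹ − 1` factor of the velocity map (`‖gSer(ad(−A))⁻¹ − 1‖ ≲ εη`,
✓`Prop7ChartVelocityDexp.norm_gSer_ad_neg_sub_one_le` — no regularity needed there) and the margin assembly are the sequel (R2b′); nothing of print is asserted; no stub ∕ crux statement is advanced.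

References: T. Bałaban, CMP 99 (1985) 389–434 [Balaban1985BackgroundPropagators] ((3.3) p.391, (3.5) p.391, (3.8) p.392); CMP 102 (1985) 277–309 [Balaban1985Variational] ((19) p.281,
(112) p.294, (115) p.295); CMP 99 (1985) 75–102 [Balaban1985RegularSpaces] ((1.1) p.76, (1.36)–(1.38) p.82).
-/

set_option autoImplicit false

noncomputable section

open scoped Matrix.Norms.L2Operator BigOperators
open NormedSpace

namespace Summit.QuantumFields.YangMills.Theorems.Prop7GaugeDirRotationDivergence

open Literature.MathematicalPhysics.QuantumFieldTheory.Balaban1983to89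
open Literature.MathematicalPhysics.QuantumFieldTheory.Balaban1983to89.T3ContinuumYM3Torus
open Literature.MathematicalPhysics.QuantumFieldTheory.Balaban1983to89.T3SectALandauChart (eta eta_pos bgUnits covGradT covDerivFwdT formComp)
open Literature.Analysis.Complex (norm_exp_le_exp_norm norm_exp_sub_exp_le)
open B7Eq78Linearization (conjR conjR_apply)
open B9SectCLatticeCarrier (unshift shift_unshift)
open Summit.QuantumFields.YangMills.Theorems.Prop7SectET3Transport (periodsT3 siteEquiv bondEquiv bgOfCfg bondEquiv_symm_apply siteEquiv_symm_shift val_bgOfCfg isUnitaryBg_bgOfCfg)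
open Summit.QuantumFields.YangMills.Theorems.Prop7SectET3HilbertLetters (W₂ toL2 toL2S DL2 DstarL2 DL2_apply DstarL2_apply)
open Summit.QuantumFields.YangMills.Theorems.Prop7SectET3GaugeProjector (DstarPi DstarPi_apply)
open Summit.QuantumFields.YangMills.Theorems.Prop7LandauDict (bondEquiv_symm_siteEquiv)
open Summit.QuantumFields.YangMills.Theorems.Prop7TwistedSliceGaugeOntoSU2 (coe_bgUnits_apply)

/-! ## §1 Conjugation by nearby exponentials -/

section Algebra

variable {𝔸 : Type*} [NormedRing 𝔸] [NormedAlgebra ℂ 𝔸] [CompleteSpace 𝔸] [NormOneClass 𝔸]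

/-- **`‖e^{P}Ze^{−P} − e^{Q}Ze^{−Q}‖ ≤ 2e^{r}e^{r}‖P − Q‖‖Z‖`** for `‖P‖, ‖Q‖ ≤ r`: `e^{P}Ze^{−P} − e^{Q}Ze^{−Q} = (e^{P} − e^{Q})Ze^{−P} + e^{Q}Z(e^{−P} − e^{−Q})` and the local Lipschitz
bound of `exp`. [folklore] -/
theorem norm_exp_conj_sub_exp_conj_le {P Q : 𝔸} {r : ℝ} (hP : ‖P‖ ≤ r) (hQ : ‖Q‖ ≤ r) (Z : 𝔸) :
    ‖exp P * Z * exp (-P) - exp Q * Z * exp (-Q)‖ ≤ 2 * (Real.exp r * Real.exp r) * ‖P - Q‖ * ‖Z‖ := by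
  have h1 : exp P * Z * exp (-P) - exp Q * Z * exp (-Q) = (exp P - exp Q) * Z * exp (-P) + exp Q * Z * (exp (-P) - exp (-Q)) := by
    noncomm_ring
  have hmax : max ‖P‖ ‖Q‖ ≤ r := max_le hP hQ
  have hePQ : ‖exp P - exp Q‖ ≤ ‖P - Q‖ * Real.exp r :=
    (norm_exp_sub_exp_le P Q).trans (mul_le_mul_of_nonneg_left (Real.exp_le_exp.2 hmax) (norm_nonneg _))
  have hemPQ : ‖exp (-P) - exp (-Q)‖ ≤ ‖P - Q‖ * Real.exp r := by
    have h2 := norm_exp_sub_exp_le (-P) (-Q)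
    rw [norm_neg, norm_neg, show (-P - -Q : 𝔸) = -(P - Q) by abel, norm_neg] at h2
    exact h2.trans (mul_le_mul_of_nonneg_left (Real.exp_le_exp.2 hmax) (norm_nonneg _))
  have heP : ‖exp (-P)‖ ≤ Real.exp r := (norm_exp_le_exp_norm _).trans (by rw [norm_neg]; exact Real.exp_le_exp.2 hP)
  have heQ : ‖exp Q‖ ≤ Real.exp r := (norm_exp_le_exp_norm _).trans (Real.exp_le_exp.2 hQ)
  rw [h1]
  calc ‖(exp P - exp Q) * Z * exp (-P) + exp Q * Z * (exp (-P) - exp (-Q))‖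
      ≤ ‖(exp P - exp Q) * Z * exp (-P)‖ + ‖exp Q * Z * (exp (-P) - exp (-Q))‖ := norm_add_le _ _
    _ ≤ ‖exp P - exp Q‖ * ‖Z‖ * ‖exp (-P)‖ + ‖exp Q‖ * ‖Z‖ * ‖exp (-P) - exp (-Q)‖ := add_le_add (norm_mul₃_le) (norm_mul₃_le)
    _ ≤ ‖P - Q‖ * Real.exp r * ‖Z‖ * Real.exp r + Real.exp r * ‖Z‖ * (‖P - Q‖ * Real.exp r) := by gcongr
    _ = 2 * (Real.exp r * Real.exp r) * ‖P - Q‖ * ‖Z‖ := by ring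

/-- **`‖e^{P}Ze^{−P} − Z‖ ≤ 2e^{r}e^{r}‖P‖‖Z‖`** for `‖P‖ ≤ r` (the case `Q = 0`). [folklore] -/
theorem norm_exp_conj_sub_self_le {P : 𝔸} {r : ℝ} (hP : ‖P‖ ≤ r) (Z : 𝔸) :
    ‖exp P * Z * exp (-P) - Z‖ ≤ 2 * (Real.exp r * Real.exp r) * ‖P‖ * ‖Z‖ := by
  have h0 : ‖(0 : 𝔸)‖ ≤ r := by rw [norm_zero]; exact (norm_nonneg P).trans hP
  have h := norm_exp_conj_sub_exp_conj_le hP h0 Z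
  rwa [neg_zero, exp_zero, one_mul, mul_one, sub_zero] at h

end Algebra

/-! ## §2 The stencil letters at the T³ member -/

section Stencil

variable (F : T3Family) {n K : ℕ} {c₀ : ℝ} [Fact (0 < c₀)]

/-- The backward bond of the (3.8) stencil, `b⁻ = (bondEquiv)⁻¹(x − e_μ, μ)`, read on the route carrier: `b⁻ = ⟨(siteEquiv)⁻¹(x − e_μ), μ⟩`. [cite: Balaban1985BackgroundPropagators, (3.8) p.392] -/
theorem bneg_eq (x : Site (F.P K) 0) (μ : Fin 3) :
    (bondEquiv F K).symm (unshift μ (siteEquiv F K x), μ) = ⟨(siteEquiv F K).symm (unshift μ (siteEquiv F K x)), μ⟩ :=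
  bondEquiv_symm_apply F K _

/-- The backward bond ends at `x`: `(x − e_μ) + e_μ = x`. [cite: Balaban1985BackgroundPropagators, (3.8) p.392] -/
theorem shift_bneg (x : Site (F.P K) 0) (μ : Fin 3) : ((siteEquiv F K).symm (unshift μ (siteEquiv F K x))).shift μ = x := by
  rw [← siteEquiv_symm_shift, shift_unshift, Equiv.symm_apply_apply]

/-- … so `b⁻.tgt = x`. [cite: Balaban1985BackgroundPropagators, (3.8) p.392] -/
theorem tgt_bneg (x : Site (F.P K) 0) (μ : Fin 3) : ((bondEquiv F K).symm (unshift μ (siteEquiv F K x), μ)).tgt = x := by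
  rw [bneg_eq]; exact shift_bneg F x μ

/-- The transporters of the stencil as `SU(2)` matrices: `↑(bgOfCfg U₀ p) = U₀(b)` and `↑(bgOfCfg U₀ p)⁻¹ = U₀(b)⋆`, `b = (bondEquiv)⁻¹ p`. [cite: Balaban1985BackgroundPropagators, (3.5) p.391] -/
theorem coe_bgOfCfg_inv (U₀ : GaugeField (F.P K) 0 (Matrix.specialUnitaryGroup (Fin 2) ℂ)) (p : B9SectCLatticeCarrier.Bond 3 (periodsT3 F K)) :
    ((((bgOfCfg F K U₀ p)⁻¹ : (Matrix (Fin 2) (Fin 2) ℂ)ˣ)) : Matrix (Fin 2) (Fin 2) ℂ) = star (((U₀ ((bondEquiv F K).symm p)) : Matrix.specialUnitaryGroup (Fin 2) ℂ) : Matrix (Fin 2) (Fin 2) ℂ) := by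
  rw [isUnitaryBg_bgOfCfg, val_bgOfCfg]

/-- `U₀(b)⋆U₀(b) = 1` and `U₀(b)U₀(b)⋆ = 1` for the `SU(2)`-valued background. [cite: Balaban1985Variational, p.277] -/
theorem star_mul_self_bg (U₀ : GaugeField (F.P K) 0 (Matrix.specialUnitaryGroup (Fin 2) ℂ)) (b : PBond (F.P K) 0) :
    star (((U₀ b) : Matrix.specialUnitaryGroup (Fin 2) ℂ) : Matrix (Fin 2) (Fin 2) ℂ) * ((U₀ b : Matrix.specialUnitaryGroup (Fin 2) ℂ) : Matrix (Fin 2) (Fin 2) ℂ) = 1 ∧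
    ((U₀ b : Matrix.specialUnitaryGroup (Fin 2) ℂ) : Matrix (Fin 2) (Fin 2) ℂ) * star (((U₀ b) : Matrix.specialUnitaryGroup (Fin 2) ℂ) : Matrix (Fin 2) (Fin 2) ℂ) = 1 :=
  ⟨Matrix.mem_unitaryGroup_iff'.1 (U₀ b).2.1, Matrix.mem_unitaryGroup_iff.1 (U₀ b).2.1⟩

/-- The `SU(2)` bond variables have operator norm `1`, and so do their adjoints. [cite: Balaban1985Variational, p.277] -/
theorem norm_coe_bg (U₀ : GaugeField (F.P K) 0 (Matrix.specialUnitaryGroup (Fin 2) ℂ)) (b : PBond (F.P K) 0) :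
    ‖((U₀ b : Matrix.specialUnitaryGroup (Fin 2) ℂ) : Matrix (Fin 2) (Fin 2) ℂ)‖ = 1 ∧ ‖star (((U₀ b) : Matrix.specialUnitaryGroup (Fin 2) ℂ) : Matrix (Fin 2) (Fin 2) ℂ)‖ = 1 := by
  have h := CStarRing.norm_of_mem_unitary (E := Matrix (Fin 2) (Fin 2) ℂ) (U₀ b).2.1
  exact ⟨h, by rw [norm_star]; exact h⟩

/-- **THE DIAGONAL COVARIANT GRADIENT IN THE STENCIL'S LETTERS**: `U₀(b⁻)⋆A(b⁻)U₀(b⁻) − A(b⁺) = −U₀(b⁻)⋆·(∇_{U₀}A)_{μμ}(x − e_μ)·U₀(b⁻)`, so its norm is at most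
`‖covGradT 1 (bgUnits U₀) A μ μ (x − e_μ)‖`. [cite: Balaban1985RegularSpaces, (1.1) p.76; Balaban1985Variational, (19) p.281] -/
theorem norm_conjA_sub_le (U₀ : GaugeField (F.P K) 0 (Matrix.specialUnitaryGroup (Fin 2) ℂ)) (A : PBond (F.P K) 0 → Matrix (Fin 2) (Fin 2) ℂ) (x : Site (F.P K) 0) (μ : Fin 3) :
    ‖star (((U₀ ((bondEquiv F K).symm (unshift μ (siteEquiv F K x), μ))) : Matrix.specialUnitaryGroup (Fin 2) ℂ) : Matrix (Fin 2) (Fin 2) ℂ) *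
          A ((bondEquiv F K).symm (unshift μ (siteEquiv F K x), μ)) *
          (((U₀ ((bondEquiv F K).symm (unshift μ (siteEquiv F K x), μ))) : Matrix.specialUnitaryGroup (Fin 2) ℂ) : Matrix (Fin 2) (Fin 2) ℂ) - A ⟨x, μ⟩‖
      ≤ ‖covGradT 1 (bgUnits F K U₀) A μ μ ((siteEquiv F K).symm (unshift μ (siteEquiv F K x)))‖ := by
  rw [bneg_eq]
  set x' : Site (F.P K) 0 := (siteEquiv F K).symm (unshift μ (siteEquiv F K x)) with hx'
  set U : Matrix (Fin 2) (Fin 2) ℂ := ((U₀ ⟨x', μ⟩ : Matrix.specialUnitaryGroup (Fin 2) ℂ) : Matrix (Fin 2) (Fin 2) ℂ) with hU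
  have hUU : star U * U = 1 ∧ U * star U = 1 := star_mul_self_bg F U₀ ⟨x', μ⟩
  have hgrad : covGradT 1 (bgUnits F K U₀) A μ μ x' = U * A ⟨x, μ⟩ * star U - A ⟨x', μ⟩ := by
    rw [covGradT, covDerivFwdT, formComp, inv_one, one_smul, conjR_apply, (coe_bgUnits_apply F U₀ _).1, (coe_bgUnits_apply F U₀ _).2]
    show ((U₀ ⟨x', μ⟩ : Matrix.specialUnitaryGroup (Fin 2) ℂ) : Matrix (Fin 2) (Fin 2) ℂ) * A ⟨x'.shift μ, μ⟩ *
        star (((U₀ ⟨x', μ⟩) : Matrix.specialUnitaryGroup (Fin 2) ℂ) : Matrix (Fin 2) (Fin 2) ℂ) - A ⟨x', μ⟩ = U * A ⟨x, μ⟩ * star U - A ⟨x', μ⟩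
    rw [hx', shift_bneg]
  have hid : star U * A ⟨x', μ⟩ * U - A ⟨x, μ⟩ = -(star U * covGradT 1 (bgUnits F K U₀) A μ μ x' * U) := by
    rw [hgrad, mul_sub, sub_mul]
    have : star U * (U * A ⟨x, μ⟩ * star U) * U = A ⟨x, μ⟩ := by
      calc star U * (U * A ⟨x, μ⟩ * star U) * U = (star U * U) * A ⟨x, μ⟩ * (star U * U) := by noncomm_ring
        _ = A ⟨x, μ⟩ := by rw [hUU.1, one_mul, mul_one]
    rw [this]; abel
  rw [hid, norm_neg]
  have hn := norm_coe_bg F U₀ ⟨x', μ⟩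
  calc ‖star U * covGradT 1 (bgUnits F K U₀) A μ μ x' * U‖ ≤ ‖star U‖ * ‖covGradT 1 (bgUnits F K U₀) A μ μ x'‖ * ‖U‖ := norm_mul₃_le
    _ = ‖covGradT 1 (bgUnits F K U₀) A μ μ x'‖ := by rw [hn.1, hn.2, one_mul, mul_one]

end Stencil

/-! ## §3 The pointwise divergence bound -/

section Main

variable (F : T3Family) {n K : ℕ} {c₀ : ℝ} [Fact (0 < c₀)]

/-- **ONE SUMMAND OF THE (3.8) STENCIL** (pure `M₂(ℂ)` algebra): with `U⋆U = 1`, `U⋆e^{B}U = e^{U⋆BU}`, `W = N_x + c•g` (the (3.3) identity at `b⁺`),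
`‖U⋆a U‖, ‖a′‖ ≤ r`: `‖U⋆[e^{a}(UN_xU⋆)e^{−a} − UN_xU⋆]U − [e^{a′}We^{−a′} − W]‖ ≤ 2e^{r}e^{r}(‖U⋆aU − a′‖‖N_x‖ + ‖a′‖‖c‖‖g‖)`. [cite: Balaban1985BackgroundPropagators, (3.3) p.391, (3.8) p.392] -/
theorem norm_stencil_summand_le {U a a' Nx W g : Matrix (Fin 2) (Fin 2) ℂ} {c : ℂ} {r : ℝ}
    (hUl : star U * U = 1)
    (hexp : ∀ B : Matrix (Fin 2) (Fin 2) ℂ, star U * exp B * U = exp (star U * B * U)) (hW : W = Nx + c • g)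
    (ha : ‖star U * a * U‖ ≤ r) (ha' : ‖a'‖ ≤ r) :
    ‖star U * (exp a * (U * Nx * star U) * exp (-a) - U * Nx * star U) * U - (exp a' * W * exp (-a') - W)‖
      ≤ 2 * (Real.exp r * Real.exp r) * (‖star U * a * U - a'‖ * ‖Nx‖ + ‖a'‖ * (‖c‖ * ‖g‖)) := by
  -- the `b⁻` term
  have hQ : star U * (U * Nx * star U) * U = Nx := by
    rw [show star U * (U * Nx * star U) * U = (star U * U) * Nx * (star U * U) by noncomm_ring, hUl, one_mul, mul_one]
  have hP : star U * (exp a * (U * Nx * star U) * exp (-a)) * U = exp (star U * a * U) * Nx * exp (-(star U * a * U)) := by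
    rw [show star U * (exp a * (U * Nx * star U) * exp (-a)) * U = (star U * exp a * U) * Nx * (star U * exp (-a) * U) by noncomm_ring,
      hexp, hexp, show star U * -a * U = -(star U * a * U) by noncomm_ring]
  have hm : star U * (exp a * (U * Nx * star U) * exp (-a) - U * Nx * star U) * U = exp (star U * a * U) * Nx * exp (-(star U * a * U)) - Nx := by
    rw [mul_sub, sub_mul, hP, hQ]
  -- the `b⁺` term
  have hp : exp a' * W * exp (-a') - W = (exp a' * Nx * exp (-a') - Nx) + (exp a' * (c • g) * exp (-a') - c • g) := by
    rw [hW, mul_add, add_mul]; abel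
  rw [hm, hp]
  calc ‖exp (star U * a * U) * Nx * exp (-(star U * a * U)) - Nx - (exp a' * Nx * exp (-a') - Nx + (exp a' * (c • g) * exp (-a') - c • g))‖
      = ‖(exp (star U * a * U) * Nx * exp (-(star U * a * U)) - exp a' * Nx * exp (-a')) - (exp a' * (c • g) * exp (-a') - c • g)‖ := by
        congr 1; abel
    _ ≤ ‖exp (star U * a * U) * Nx * exp (-(star U * a * U)) - exp a' * Nx * exp (-a')‖ + ‖exp a' * (c • g) * exp (-a') - c • g‖ := norm_sub_le _ _
    _ ≤ 2 * (Real.exp r * Real.exp r) * ‖star U * a * U - a'‖ * ‖Nx‖ + 2 * (Real.exp r * Real.exp r) * ‖a'‖ * ‖c • g‖ :=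
        add_le_add (norm_exp_conj_sub_exp_conj_le ha ha' _) (norm_exp_conj_sub_self_le ha' _)
    _ = 2 * (Real.exp r * Real.exp r) * (‖star U * a * U - a'‖ * ‖Nx‖ + ‖a'‖ * (‖c‖ * ‖g‖)) := by rw [norm_smul]; ring

/-- ★★★ **(E1) THE `U₀`-DIVERGENCE OF THE ROTATED GAUGE DIRECTION IS `O(ε·η)` POINTWISE.**  For an `SU(2)` background `U₀`, a perturbation exponent `A` with `‖A(b)‖ ≤ ε·η`
(clause 1 of (19)) and DIAGONAL covariant gradients `‖(∇^1_{U₀}A)_{μμ}(x)‖ ≤ ε·η²` (clause 2 of (19), diagonal entries), and any gauge parameter `N`: at every site `x`,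
`‖D*_{U₀}(b ↦ e^{A(b)}U₀(b)N(b₊)U₀(b)⋆e^{−A(b)} − U₀(b)N(b₊)U₀(b)⋆)(x)‖ ≤ 2e^{εη}e^{εη}·ε·η·(3‖N(x)‖ + Σ_μ ‖(D_{U₀}N)(x, x + e_μ)‖)` — `D*_{U₀}` = ✓`DstarPi` (stencil (3.8)),
`D_{U₀}N` = `toL2⁻¹(DL2 U₀ (toL2S N))` (stencil (3.3)).  The `η` in front is what the pairing margin needs; it comes from clause 2. [cite: Balaban1985BackgroundPropagators, (3.3) p.391, (3.8) p.392; Balaban1985Variational, (19) p.281, (112) p.294] -/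
theorem norm_DstarPi_rot_le (U₀ : GaugeField (F.P K) 0 (Matrix.specialUnitaryGroup (Fin 2) ℂ)) (A : PBond (F.P K) 0 → Matrix (Fin 2) (Fin 2) ℂ) {ε : ℝ}
    (hA0 : ∀ b, ‖A b‖ ≤ ε * eta F n K) (hA1 : ∀ (μ : Fin 3) (x : Site (F.P K) 0), ‖covGradT 1 (bgUnits F K U₀) A μ μ x‖ ≤ ε * eta F n K ^ 2)
    (N : Site (F.P K) 0 → Matrix (Fin 2) (Fin 2) ℂ) (x : Site (F.P K) 0) :
    ‖DstarPi F n K c₀ U₀ (fun b => exp (A b) * (((U₀ b : Matrix.specialUnitaryGroup (Fin 2) ℂ) : Matrix (Fin 2) (Fin 2) ℂ) * N b.tgt *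
          star (((U₀ b) : Matrix.specialUnitaryGroup (Fin 2) ℂ) : Matrix (Fin 2) (Fin 2) ℂ)) * exp (-(A b)) -
        ((U₀ b : Matrix.specialUnitaryGroup (Fin 2) ℂ) : Matrix (Fin 2) (Fin 2) ℂ) * N b.tgt * star (((U₀ b) : Matrix.specialUnitaryGroup (Fin 2) ℂ) : Matrix (Fin 2) (Fin 2) ℂ)) x‖
      ≤ 2 * (Real.exp (ε * eta F n K) * Real.exp (ε * eta F n K)) * ε * eta F n K *
          (3 * ‖N x‖ + ∑ μ : Fin 3, ‖(toL2 F K c₀).symm (DL2 F n K c₀ U₀ (toL2S F K c₀ N)) ⟨x, μ⟩‖) := by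
  have hη : 0 < eta F n K := eta_pos F n K
  have hη' : ((eta F n K : ℝ) : ℂ) ≠ 0 := by exact_mod_cast hη.ne'
  -- each summand of the (3.8) stencil
  have hsum : ∀ μ : Fin 3,
      ‖(((bgOfCfg F K U₀ (unshift μ (siteEquiv F K x), μ))⁻¹ : (Matrix (Fin 2) (Fin 2) ℂ)ˣ) : Matrix (Fin 2) (Fin 2) ℂ) *
            (fun b : PBond (F.P K) 0 => exp (A b) * (((U₀ b : Matrix.specialUnitaryGroup (Fin 2) ℂ) : Matrix (Fin 2) (Fin 2) ℂ) * N b.tgt *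
                star (((U₀ b) : Matrix.specialUnitaryGroup (Fin 2) ℂ) : Matrix (Fin 2) (Fin 2) ℂ)) * exp (-(A b)) -
              ((U₀ b : Matrix.specialUnitaryGroup (Fin 2) ℂ) : Matrix (Fin 2) (Fin 2) ℂ) * N b.tgt * star (((U₀ b) : Matrix.specialUnitaryGroup (Fin 2) ℂ) : Matrix (Fin 2) (Fin 2) ℂ))
              ((bondEquiv F K).symm (unshift μ (siteEquiv F K x), μ)) *
            ((bgOfCfg F K U₀ (unshift μ (siteEquiv F K x), μ) : (Matrix (Fin 2) (Fin 2) ℂ)ˣ) : Matrix (Fin 2) (Fin 2) ℂ) -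
          (fun b : PBond (F.P K) 0 => exp (A b) * (((U₀ b : Matrix.specialUnitaryGroup (Fin 2) ℂ) : Matrix (Fin 2) (Fin 2) ℂ) * N b.tgt *
                star (((U₀ b) : Matrix.specialUnitaryGroup (Fin 2) ℂ) : Matrix (Fin 2) (Fin 2) ℂ)) * exp (-(A b)) -
              ((U₀ b : Matrix.specialUnitaryGroup (Fin 2) ℂ) : Matrix (Fin 2) (Fin 2) ℂ) * N b.tgt * star (((U₀ b) : Matrix.specialUnitaryGroup (Fin 2) ℂ) : Matrix (Fin 2) (Fin 2) ℂ))
              ((bondEquiv F K).symm (siteEquiv F K x, μ))‖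
        ≤ 2 * (Real.exp (ε * eta F n K) * Real.exp (ε * eta F n K)) *
            ((ε * eta F n K ^ 2) * ‖N x‖ + (ε * eta F n K) * (eta F n K * ‖(toL2 F K c₀).symm (DL2 F n K c₀ U₀ (toL2S F K c₀ N)) ⟨x, μ⟩‖)) := by
    intro μ
    simp only []
    rw [coe_bgOfCfg_inv, val_bgOfCfg, bondEquiv_symm_siteEquiv F K x μ, tgt_bneg]
    set bm : PBond (F.P K) 0 := (bondEquiv F K).symm (unshift μ (siteEquiv F K x), μ) with hbm
    have hUU := star_mul_self_bg F U₀ bm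
    have hnU := norm_coe_bg F U₀ bm
    have hexp : ∀ B : Matrix (Fin 2) (Fin 2) ℂ, star (((U₀ bm : Matrix.specialUnitaryGroup (Fin 2) ℂ)) : Matrix (Fin 2) (Fin 2) ℂ) * exp B *
        ((U₀ bm : Matrix.specialUnitaryGroup (Fin 2) ℂ) : Matrix (Fin 2) (Fin 2) ℂ) =
        exp (star (((U₀ bm : Matrix.specialUnitaryGroup (Fin 2) ℂ)) : Matrix (Fin 2) (Fin 2) ℂ) * B * ((U₀ bm : Matrix.specialUnitaryGroup (Fin 2) ℂ) : Matrix (Fin 2) (Fin 2) ℂ)) := by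
      intro B
      have h1 := Matrix.exp_units_conj' (bgUnits F K U₀ bm) B
      rw [(coe_bgUnits_apply F U₀ bm).1, (coe_bgUnits_apply F U₀ bm).2] at h1
      exact h1.symm
    -- (3.3) at `b⁺ = ⟨x, μ⟩`
    have hW : ((U₀ ⟨x, μ⟩ : Matrix.specialUnitaryGroup (Fin 2) ℂ) : Matrix (Fin 2) (Fin 2) ℂ) * N (⟨x, μ⟩ : PBond (F.P K) 0).tgt *
        star (((U₀ ⟨x, μ⟩) : Matrix.specialUnitaryGroup (Fin 2) ℂ) : Matrix (Fin 2) (Fin 2) ℂ) =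
        N x + ((eta F n K : ℝ) : ℂ) • (toL2 F K c₀).symm (DL2 F n K c₀ U₀ (toL2S F K c₀ N)) ⟨x, μ⟩ := by
      have hG1 : (toL2 F K c₀).symm (DL2 F n K c₀ U₀ (toL2S F K c₀ N)) ⟨x, μ⟩ = (((eta F n K : ℝ) : ℂ)⁻¹) •
          (((U₀ ⟨x, μ⟩ : Matrix.specialUnitaryGroup (Fin 2) ℂ) : Matrix (Fin 2) (Fin 2) ℂ) * N (⟨x, μ⟩ : PBond (F.P K) 0).tgt *
            star (((U₀ ⟨x, μ⟩) : Matrix.specialUnitaryGroup (Fin 2) ℂ) : Matrix (Fin 2) (Fin 2) ℂ) - N x) := by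
        rw [DL2_apply, coe_bgOfCfg_inv, Equiv.symm_apply_apply]
      rw [hG1, smul_smul, mul_inv_cancel₀ hη', one_smul, add_sub_cancel]
    have ha : ‖star (((U₀ bm : Matrix.specialUnitaryGroup (Fin 2) ℂ)) : Matrix (Fin 2) (Fin 2) ℂ) * A bm * ((U₀ bm : Matrix.specialUnitaryGroup (Fin 2) ℂ) : Matrix (Fin 2) (Fin 2) ℂ)‖
        ≤ ε * eta F n K := by
      calc _ ≤ ‖star (((U₀ bm : Matrix.specialUnitaryGroup (Fin 2) ℂ)) : Matrix (Fin 2) (Fin 2) ℂ)‖ * ‖A bm‖ * ‖((U₀ bm : Matrix.specialUnitaryGroup (Fin 2) ℂ) : Matrix (Fin 2) (Fin 2) ℂ)‖ :=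
            norm_mul₃_le
        _ = ‖A bm‖ := by rw [hnU.1, hnU.2, one_mul, mul_one]
        _ ≤ ε * eta F n K := hA0 bm
    have hdiff := (norm_conjA_sub_le F U₀ A x μ).trans (hA1 μ _)
    refine (norm_stencil_summand_le hUU.1 hexp hW ha (hA0 ⟨x, μ⟩)).trans ?_
    have h2 : 0 ≤ 2 * (Real.exp (ε * eta F n K) * Real.exp (ε * eta F n K)) := by positivity
    refine mul_le_mul_of_nonneg_left (add_le_add ?_ ?_) h2
    · exact mul_le_mul_of_nonneg_right hdiff (norm_nonneg _)
    · rw [Complex.norm_real, Real.norm_of_nonneg hη.le]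
      exact mul_le_mul_of_nonneg_right (hA0 ⟨x, μ⟩) (by positivity)
  -- the stencil and the sum over the three directions
  rw [DstarPi_apply, DstarL2_apply, norm_smul, norm_inv, Complex.norm_real, Real.norm_of_nonneg hη.le]
  refine (mul_le_mul_of_nonneg_left ((norm_sum_le _ _).trans (Finset.sum_le_sum fun μ _ => hsum μ)) (inv_nonneg.2 hη.le)).trans (le_of_eq ?_)
  rw [← Finset.mul_sum, Finset.sum_add_distrib, Finset.sum_const, Finset.card_univ, Fintype.card_fin, ← Finset.mul_sum, ← Finset.mul_sum]
  field_simp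
  ring

end Main

end Summit.QuantumFields.YangMills.Theorems.Prop7GaugeDirRotationDivergence

end
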